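import Summits.AnomalousDissipation.AnomalousDissipation.Theorems.TwoAndHalfDTwohalfdNegRegularCondensateRestart
import Summits.AnomalousDissipation.AnomalousDissipation.Theorems.TwoAndHalfDTwohalfdNegRegularCondensateSelection
import Summits.AnomalousDissipation.AnomalousDissipation.Theorems.TwoAndHalfDTwohalfdNegRegularCondensateLevel
import Summits.AnomalousDissipation.AnomalousDissipation.Theorems.TwoAndHalfDTwohalfdNegRegularCondensateArzelaAscoli
import Summits.AnomalousDissipation.AnomalousDissipation.Theorems.TwoAndHalfDTwohalfdNegRegularCondensateWeakLimit
import Summits.AnomalousDissipation.AnomalousDissipation.Theorems.TwoAndHalfDTwohalfdNegRegularCondensateLimit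
import Summits.AnomalousDissipation.AnomalousDissipation.Theorems.TwoAndHalfDTwohalfdNegRegularCondensateContradiction
import Summits.AnomalousDissipation.AnomalousDissipation.Theorems.TwoAndHalfDTwohalfdNegCondensate

/-!
# The regular-condensate theorem for the crux `TwoAndHalfD.TwohalfdNeg` (stmt-AnomalousDissipation-0211)

Line `log-kantorovich-enstrophy-transfer`, lead c7.  The condensate theorem of lead c6
(`Condensate.scalarNoAnomaly_of_condensate`: `L²`-condensation of the planar Leray–Hopf flow onto a
smooth STEADY divergence-free field kills the steady-source scalar anomaly) freed from steadiness:

* `scalarNoAnomaly_of_regularCondensate` (planar form).  `g` smooth mean-zero steady force, `h` smooth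
  mean-zero steady source, comparison flows `W_j : ℝ × T² → ℝ²` that are UNIFORMLY bounded, UNIFORMLY
  Lipschitz in space–time (one constant `L`) and weakly divergence free at every time, `ν_j → 0`, `v_j`
  global Leray–Hopf (planar NS forced by `g`), `θ_j` global weak sourced scalars over `v_j` with
  `ν`-uniformly bounded `limsup`-mean variance, and REGULAR CONDENSATION `⟨‖v_j − W_j‖²_{L²(T²)}⟩ → 0`
  (`limsup`-mean) ⇒ `⟨ν_j‖∇θ_j‖²⟩ → 0`.  Contains the steady case (`W_j = V`), time-periodic and
  quasi-periodic condensates, Galilean-drifting patterns `V(x − ct)`, slowly modulated condensates,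
  finitely many smooth vortices moving with bounded speeds, `j`-dependent comparison flows.
* `twohalfdNeg_family_of_regularCondensate` (crux form): the crux `TwohalfdNeg` restricted to
  bounded-energy `x₃`-invariant global Leray–Hopf families whose planar velocity is so approximable
  (`⟨∫_{T³}‖π_E u_j − W_j ∘ π‖²⟩ → 0`): `meanDissipation → 0` (reduction S1' + Alexakis–Doering S2 + the
  planar form).

PROOF (block architecture, eleven registered stubs, all landed as `Theorems/…RegularCondensate*.lean`).
If `⟨ν_j‖∇θ_j‖²⟩ ≥ 3ε` along a subsequence, fix the block length `S = S₀ + 1` with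
`S₀ = 2Λ(c² + 8(∫h²)Λ)/c³`, `c = ε/2`, `Λ = λ(E+1)/2`, `λ = 64(∫h²)(E+1)/ε² + 4`.  At every level:
restart times of full measure (`stub_rcRestart`), a good block `[a, a+S]` (`stub_rcSelection`: power
`≥ εS/2`, variance mass `≤ λ(E+1)S`, fluctuation mass `≤ λδ_jS → 0`, `‖θ(a)‖² ≤ λ(E+1)`), the level
package on `(0,S) × T²` (`stub_rcLevel`).  Along the sequence: Arzelà–Ascoli for the shifted comparison
flows (`stub_rcArzelaAscoli`), joint weak `L²` limits (`stub_rcWeakLimit`), the limit is a weak solution of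
the sourced TRANSPORT equation `∂ₜΘ + W'·∇Θ = h` (`stub_rcLimit`) with power `≥ cS` and level `≤ 2ΛS`,
whence `S ≤ S₀` (`stub_rcContradiction` = DiPerna–Lions conservative balance `stub_rcTransportEnergyEq` +
ODE endgame `stub_rcEndgame`): contradiction.  After c7 the certified perimeter of the crux reads: an
`X`-witness (0448/0206) must keep a non-vanishing space–time-ROUGH component at leading order in energy
(positive `limsup`-mean `L²` distance to every uniformly Lipschitz divergence-free space–time field) AND
mean strain `≳ log(1/ν_j)` (S6 certificate).  Supports stmt-AnomalousDissipation-0211; closes with the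
registered tools stub `stub_rcCertificate`.
-/

namespace Summit.AnomalousDissipation.AnomalousDissipation.Theorems.TwohalfdNeg.RegularCondensate

open MeasureTheory Filter Topology Set
open scoped ENNReal NNReal InnerProductSpace
open Literature.Analysis.FunctionSpaces Literature.Analysis.FluidPDE
open Summit.AnomalousDissipation.AnomalousDissipation.Theorems.TwohalfdNeg

set_option linter.dupNamespace false

/-! ## Small tools -/

/-- Time shifts preserve the space–time Lipschitz constant: `(t, x) ↦ W (a + t) x` is `L`-Lipschitz if
`W` is. [folklore] -/
theorem lipschitzWith_uncurry_shift {L : ℝ≥0} {W : ℝ → UnitAddTorus (Fin 2) → EuclideanSpace ℝ (Fin 2)}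
    (hW : LipschitzWith L (Function.uncurry W)) (a : ℝ) :
    LipschitzWith L (Function.uncurry fun t => W (a + t)) := by
  refine LipschitzWith.of_dist_le_mul fun p q => ?_
  have h := hW.dist_le_mul (a + p.1, p.2) (a + q.1, q.2)
  have hd : dist (a + p.1, p.2) (a + q.1, q.2) = dist p q := by
    rw [Prod.dist_eq, Prod.dist_eq, dist_add_left]
  simpa [Function.uncurry, hd] using h

/-- A space–time Lipschitz field is Lipschitz in space at every time, with the same constant. [folklore] -/
theorem lipschitzWith_slice {L : ℝ≥0} {W : ℝ → UnitAddTorus (Fin 2) → EuclideanSpace ℝ (Fin 2)}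
    (hW : LipschitzWith L (Function.uncurry W)) (t : ℝ) : LipschitzWith L (W t) := by
  refine LipschitzWith.of_dist_le_mul fun x y => ?_
  have h := hW.dist_le_mul (t, x) (t, y)
  have hd : dist (t, x) (t, y) = dist x y := by
    rw [Prod.dist_eq, dist_self, max_eq_right dist_nonneg]
  simpa [Function.uncurry, hd] using h

/-! ## The planar regular-condensate theorem -/

/-- **The planar regular-condensate theorem.** `g` smooth mean-zero steady force, `h` smooth mean-zero
steady source, comparison flows `W_j` uniformly bounded by `L`, uniformly `L`-Lipschitz on `ℝ × T²` and
weakly divergence free at every time; `ν_j > 0`, `ν_j → 0`; `v_j` global Leray–Hopf solutions of the planar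
Navier–Stokes equations forced by `g` (any `L²` data); `θ_j` global weak solutions of
`∂ₜθ + v_j·∇θ = ν_jΔθ + h` from `L²` data with `ν`-uniformly bounded `limsup`-mean variance; and
REGULAR CONDENSATION `⟨∫‖v_j − W_j‖²⟩ → 0`.  THEN `⟨ν_j‖∇θ_j‖²⟩ → 0`.  Block architecture over the eleven
landed `stub_rc*` stubs (module docstring). [folklore] -/
theorem scalarNoAnomaly_of_regularCondensate :
    ∀ (g : UnitAddTorus (Fin 2) → EuclideanSpace ℝ (Fin 2)) (h : UnitAddTorus (Fin 2) → ℝ) (L : ℝ≥0)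
      (W : ℕ → ℝ → UnitAddTorus (Fin 2) → EuclideanSpace ℝ (Fin 2)),
      Torus.IsSmooth g → Torus.HasZeroMean g → Torus.IsSmooth h → Torus.HasZeroMean h →
      (∀ j, LipschitzWith L (Function.uncurry (W j))) → (∀ j t x, ‖W j t x‖ ≤ L) →
      (∀ j t, Torus.IsWeaklyDivFree (W j t)) →
      ∀ (ν : ℕ → ℝ) (v₀ : ℕ → UnitAddTorus (Fin 2) → EuclideanSpace ℝ (Fin 2))
        (v : ℕ → ℝ → UnitAddTorus (Fin 2) → EuclideanSpace ℝ (Fin 2))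
        (θ₀ : ℕ → UnitAddTorus (Fin 2) → ℝ) (θ : ℕ → ℝ → UnitAddTorus (Fin 2) → ℝ),
        (∀ j, 0 < ν j) → Tendsto ν atTop (𝓝 0) →
        (∀ j, Torus.IsGlobalLerayHopf (ν j) (fun _ => g) (v₀ j) (v j)) →
        Tendsto (fun j => longTimeAvgSup (fun t => ∫ x, ‖v j t x - W j t x‖ ^ 2)) atTop (𝓝 0) →
        (∀ j, MemLp (θ₀ j) 2 volume) →
        (∀ j, Torus.IsWeakScalarTransportForced (ν j) (v j) (fun _ => h) (θ₀ j) (θ j)) →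
        (∃ E : ℝ, ∀ j, longTimeAvgSup (fun t => Torus.scalarL2Sq (θ j t)) ≤ E) →
        Tendsto (fun j => longTimeAvgSup (fun t => ν j * (Torus.eScalarGradNormSq (θ j t)).toReal))
          atTop (𝓝 0) := by
  intro g h L W hgs hgz hhs hhz hWlip hWbd hWdiv ν v₀ v θ₀ θ hν hν0 hLH hfluct hθ₀ hθw hEθ
  obtain ⟨E, hE⟩ := hEθ
  by_contra hnt
  -- Step 0: an anomaly floor along a subsequence
  have hD0 : ∀ j, 0 ≤ longTimeAvgSup (fun t => ν j * (Torus.eScalarGradNormSq (θ j t)).toReal) :=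
    fun j => longTimeAvgSup_nonneg fun t => mul_nonneg (hν j).le ENNReal.toReal_nonneg
  have hfreq : ∃ ε : ℝ, 0 < ε ∧ ∃ᶠ j in atTop,
      ε ≤ longTimeAvgSup (fun t => ν j * (Torus.eScalarGradNormSq (θ j t)).toReal) := by
    by_contra hall
    push Not at hall
    apply hnt
    rw [tendsto_order]
    exact ⟨fun b hb => Eventually.of_forall fun j => hb.trans_le (hD0 j), fun b hb => hall b hb⟩
  obtain ⟨ε', hε', hfr⟩ := hfreq
  obtain ⟨φ, hφ, hφε⟩ := extraction_of_frequently_atTop hfr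
  -- Step 1: constants
  set ε : ℝ := ε' / 3 with hε_def
  have hε : 0 < ε := by positivity
  have hE0 : 0 ≤ E :=
    le_trans (longTimeAvgSup_nonneg fun t => integral_nonneg fun _ => sq_nonneg _) (hE 0)
  set Eθ : ℝ := E + 1 with hEθ_def
  have hEθ : 0 < Eθ := by positivity
  have hH0 : 0 ≤ ∫ x, h x ^ 2 := integral_nonneg fun _ => sq_nonneg _
  set lam : ℝ := 64 * (∫ x, h x ^ 2) * Eθ / ε ^ 2 + 4 with hlam_def
  have hlam : 0 < lam := by positivity
  set c : ℝ := ε / 2 with hc_def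
  have hc : 0 < c := by positivity
  set Λ : ℝ := lam * Eθ / 2 with hΛ_def
  have hΛ : 0 ≤ Λ := by positivity
  set S₀ : ℝ := 2 * Λ * (c ^ 2 + 8 * (∫ x, h x ^ 2) * Λ) / c ^ 3 with hS₀_def
  have hS₀ : 0 ≤ S₀ := by positivity
  set S : ℝ := S₀ + 1 with hS_def
  have hS : 0 < S := by positivity
  -- fluctuation tolerances along the subsequence
  have hF0 : ∀ j, 0 ≤ longTimeAvgSup (fun t => ∫ x, ‖v j t x - W j t x‖ ^ 2) := fun j =>
    longTimeAvgSup_nonneg fun t => integral_nonneg fun _ => sq_nonneg _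
  set δ : ℕ → ℝ := fun k => longTimeAvgSup (fun t => ∫ x, ‖v (φ k) t x - W (φ k) t x‖ ^ 2) +
    1 / ((k : ℝ) + 1) with hδ_def
  have hδ0 : ∀ k, 0 < δ k := fun k => add_pos_of_nonneg_of_pos (hF0 _) (by positivity)
  have hδlim : Tendsto δ atTop (𝓝 0) := by
    have h1 : Tendsto (fun k => longTimeAvgSup (fun t => ∫ x, ‖v (φ k) t x - W (φ k) t x‖ ^ 2))
        atTop (𝓝 0) := hfluct.comp hφ.tendsto_atTop
    have h2 := h1.add (tendsto_one_div_add_atTop_nhds_zero_nat (𝕜 := ℝ))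
    rw [add_zero] at h2
    exact h2
  -- block constants
  set Cv : ℝ := lam * Eθ * S with hCv_def
  set Cz : ℝ := lam * Eθ with hCz_def
  set C₁ : ℝ := Cz + (∫ x, h x ^ 2) * S + Cv with hC₁_def
  have hWc : ∀ j, Continuous (Function.uncurry (W j)) := fun j => (hWlip j).continuous
  have hWbd' : ∀ j t x, ‖W j t x‖ ≤ (L : ℝ) := hWbd
  -- Step 2: at every level, a restart-good selected block
  have hblock : ∀ k, ∃ a : ℝ,
      (MemLp (θ (φ k) a) 2 volume ∧ Torus.IsWeakScalarTransportForced (ν (φ k))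
        (fun t => v (φ k) (a + t)) (fun _ => h) (θ (φ k) a) (fun t => θ (φ k) (a + t))) ∧
      0 < a ∧
      ε / 2 * S ≤ ∫ t in Ioc a (a + S), ∫ x, θ (φ k) t x * h x ∧
      ∫ t in Ioc a (a + S), Torus.scalarL2Sq (θ (φ k) t) ≤ lam * Eθ * S ∧
      ∫ t in Ioc a (a + S), ∫ x, ‖v (φ k) t x - W (φ k) t x‖ ^ 2 ≤ lam * δ k * S ∧
      Torus.scalarL2Sq (θ (φ k) a) ≤ lam * Eθ := by
    intro k
    have hG := stub_rcRestart (ν (φ k)) (v (φ k)) h (θ₀ (φ k)) (θ (φ k)) hhs (hθ₀ _) (hθw _)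
    have hfloor : 2 * ε < longTimeAvgSup
        (fun t => ν (φ k) * (Torus.eScalarGradNormSq (θ (φ k) t)).toReal) := by
      have := hφε k
      rw [hε_def]
      linarith
    have hvar : longTimeAvgSup (fun t => Torus.scalarL2Sq (θ (φ k) t)) < Eθ := by
      rw [hEθ_def]; linarith [hE (φ k)]
    have hfl : longTimeAvgSup (fun t => ∫ x, ‖v (φ k) t x - W (φ k) t x‖ ^ 2) < δ k := by
      rw [hδ_def]; simp only; linarith [one_div_pos.2 (by positivity : (0 : ℝ) < (k : ℝ) + 1)]
    obtain ⟨a, haG, ha0, hpow, hvm, hfm, hz⟩ := stub_rcSelection (ν (φ k)) g (v₀ (φ k)) (v (φ k))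
      (W (φ k)) h (θ₀ (φ k)) (θ (φ k)) _ ε Eθ (δ k) S L (hν _) hgs hgz (hLH _) (hWc _) (hWbd' _)
      hhs hhz (hθ₀ _) (hθw _) hG hε hS (hδ0 k) hfloor hvar hfl
    exact ⟨a, haG, ha0, hpow, hvm, hfm, hz⟩
  choose a ha using hblock
  -- Step 3: the level packages
  have hlevel := fun k => stub_rcLevel (ν (φ k)) (a k) S L Cv (lam * δ k * S) Cz g (v₀ (φ k))
    (v (φ k)) (W (φ k)) h (θ₀ (φ k)) (θ (φ k)) (hν _) (ha k).2.1 hS hgs hgz (hLH _) (hWc _) (hWbd' _)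
    hhs (hθ₀ _) (hθw _) (ha k).1.1 (ha k).1.2 (ha k).2.2.2.1 (ha k).2.2.2.2.1 (ha k).2.2.2.2.2
  -- restarted sequences
  set ϑ : ℕ → ℝ → UnitAddTorus (Fin 2) → ℝ := fun k t => θ (φ k) (a k + t) with hϑ_def
  set ϑ₀ : ℕ → UnitAddTorus (Fin 2) → ℝ := fun k => θ (φ k) (a k) with hϑ₀_def
  set vs : ℕ → ℝ → UnitAddTorus (Fin 2) → EuclideanSpace ℝ (Fin 2) := fun k t => v (φ k) (a k + t)
    with hvs_def
  set Ws : ℕ → ℝ → UnitAddTorus (Fin 2) → EuclideanSpace ℝ (Fin 2) := fun k t => W (φ k) (a k + t)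
    with hWs_def
  -- Step 4: Arzelà–Ascoli for the shifted comparison flows
  obtain ⟨φ₁, W', hφ₁, hW'lip, hW'bd, hW'div, hunif⟩ := stub_rcArzelaAscoli L S Ws hS
    (fun k => lipschitzWith_uncurry_shift (hWlip (φ k)) (a k)) (fun k t x => hWbd _ _ _)
    (fun k t => hWdiv _ _)
  -- Step 5: joint weak limits along `φ₁`
  obtain ⟨φ₂, Θ, Θ₀, hφ₂, hΘm, hΘi, hΘbd, hΘsl, hΘ₀m, hΘ₀bd, hconv, hconv₀⟩ :=
    stub_rcWeakLimit S Cv Cz C₁ (fun n => ϑ (φ₁ n)) (fun n => ϑ₀ (φ₁ n)) hS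
      (fun n => (hlevel (φ₁ n)).2.1) (fun n => (hlevel (φ₁ n)).2.2.1)
      (fun n => (hlevel (φ₁ n)).2.2.2.1) (fun n => (hlevel (φ₁ n)).2.2.2.2.1)
      (fun n => (ha (φ₁ n)).1.1) (fun n => (ha (φ₁ n)).2.2.2.2.2)
  -- Step 6: the limit solves the sourced transport equation
  set ψ : ℕ → ℕ := fun n => φ₁ (φ₂ n) with hψ_def
  have hψ : Tendsto ψ atTop atTop := hφ₁.tendsto_atTop.comp hφ₂.tendsto_atTop
  have hνlim : Tendsto (fun n => ν (φ (ψ n))) atTop (𝓝 0) :=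
    (hν0.comp hφ.tendsto_atTop).comp hψ
  have hfluct_lim : Tendsto (fun n => ∫⁻ p, ‖vs (ψ n) p.1 p.2 - Ws (ψ n) p.1 p.2‖ₑ ^ 2
      ∂(((volume : Measure ℝ).restrict (Ioo 0 S)).prod volume)) atTop (𝓝 0) := by
    have hup : Tendsto (fun n => ENNReal.ofReal (lam * δ (ψ n) * S)) atTop (𝓝 0) := by
      have h1 : Tendsto (fun n => lam * δ (ψ n) * S) atTop (𝓝 (lam * 0 * S)) :=
        ((hδlim.comp hψ).const_mul lam).mul_const S
      rw [mul_zero, zero_mul] at h1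
      simpa using ENNReal.tendsto_ofReal h1
    exact tendsto_of_tendsto_of_tendsto_of_le_of_le tendsto_const_nhds hup (fun n => zero_le)
      fun n => (hlevel (ψ n)).2.2.2.2.2.1
  have hclass : Torus.IsWeakScalarTransportForcedOn S 0 W' (fun _ => h) Θ₀ Θ :=
    stub_rcLimit S L Cv C₁ h (fun n => ν (φ (ψ n))) (fun n => vs (ψ n)) (fun n => Ws (ψ n)) W'
      (fun n => ϑ₀ (ψ n)) (fun n => ϑ (ψ n)) Θ₀ Θ hS hhs hνlim (fun n => (ha (ψ n)).1.1)
      (fun n => (hlevel (ψ n)).1) (fun n => (hlevel (ψ n)).2.2.1) (fun n => (hlevel (ψ n)).2.2.2.1)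
      (fun n => (lipschitzWith_uncurry_shift (hWlip (φ (ψ n))) (a (ψ n))).continuous)
      (fun n t x => hWbd _ _ _) hfluct_lim
      hW'lip.continuous hW'bd hW'div (fun d hd => hφ₂.tendsto_atTop.eventually (hunif d hd))
      hΘm hΘi hΘsl hΘ₀m hconv hconv₀
  -- Step 7: power and level of the limit
  obtain ⟨Ch, hCh⟩ := Torus.exists_forall_norm_le_of_continuous hhs.continuous
  have hpowlim : c * S ≤
      ∫ p, Θ p.1 p.2 * h p.2 ∂(((volume : Measure ℝ).restrict (Ioo 0 S)).prod volume) := by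
    have ht := hconv (fun p => h p.2)
      ((hhs.continuous.comp continuous_snd).aestronglyMeasurable) ⟨Ch, fun p => by
        rw [← Real.norm_eq_abs]; exact hCh p.2⟩
    refine ge_of_tendsto ht (Eventually.of_forall fun n => ?_)
    show c * S ≤ ∫ p, ϑ (ψ n) p.1 p.2 * h p.2 ∂(((volume : Measure ℝ).restrict (Ioo 0 S)).prod volume)
    rw [hc_def, (hlevel (ψ n)).2.2.2.2.2.2]
    exact (ha (ψ n)).2.2.1
  have hlevlim : ∫ p, Θ p.1 p.2 ^ 2 ∂(((volume : Measure ℝ).restrict (Ioo 0 S)).prod volume) ≤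
      2 * Λ * S := by
    have : Cv = 2 * Λ * S := by rw [hCv_def, hΛ_def]; ring
    rw [← this]
    exact hΘbd
  -- Step 8: the endgame bound contradicts the choice of `S`
  have hbound := stub_rcContradiction S c Λ L h W' Θ₀ Θ hS hc hΛ hhs hΘ₀m hW'lip.continuous
    (lipschitzWith_slice hW'lip) hclass hΘm hΘi hlevlim hpowlim
  have : S ≤ S₀ := hbound
  linarith

/-! ## The crux on regularly condensing `x₃`-invariant families -/

/-- **The crux `TwohalfdNeg` on regularly condensing families.** For an `x₃`-invariant smooth
divergence-free mean-zero steady force `f` on `T³`, comparison flows `W_j` on `ℝ × T²` uniformly bounded,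
uniformly Lipschitz and weakly divergence free at every time, and a family of `x₃`-invariant global
Leray–Hopf solutions `u_j` of NS_{ν_j}, `ν_j → 0`, arbitrary `L²` data, with `ν`-uniformly bounded
`limsup`-mean energy, WHOSE PLANAR VELOCITY IS `L²`-ASYMPTOTIC TO `W_j` in `limsup`-mean —
`⟨∫_{T³}‖π_E u_j − W_j(t) ∘ π‖²⟩ → 0` — the mean dissipation tends to `0`.  Reduction S1'
(`ReductionOffZero.stub_reductionOffZero`), Alexakis–Doering S2 (`PlanarNoAnomaly.stub_planarNoAnomaly`)
and the planar theorem `scalarNoAnomaly_of_regularCondensate` (the hypothesis transfers to the planar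
section because the `limsup` means do not see `t = 0`). [folklore] -/
theorem twohalfdNeg_family_of_regularCondensate :
    ∀ f : UnitAddTorus (Fin 3) → EuclideanSpace ℝ (Fin 3),
      (∀ (s : UnitAddCircle) (x : UnitAddTorus (Fin 3)), f (x + Pi.single (2 : Fin 3) s) = f x) →
      Torus.IsSmooth f → Torus.IsDivFree f → Torus.HasZeroMean f →
      ∀ (L : ℝ≥0) (W : ℕ → ℝ → UnitAddTorus (Fin 2) → EuclideanSpace ℝ (Fin 2)),
        (∀ j, LipschitzWith L (Function.uncurry (W j))) → (∀ j t x, ‖W j t x‖ ≤ L) →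
        (∀ j t, Torus.IsWeaklyDivFree (W j t)) →
      ∀ (ν : ℕ → ℝ) (u₀ : ℕ → UnitAddTorus (Fin 3) → EuclideanSpace ℝ (Fin 3))
        (u : ℕ → ℝ → UnitAddTorus (Fin 3) → EuclideanSpace ℝ (Fin 3)),
        (∀ j, 0 < ν j) → Tendsto ν atTop (𝓝 0) →
        (∀ j, Torus.IsGlobalLerayHopf (ν j) (fun _ => f) (u₀ j) (u j)) →
        (∀ j (t : ℝ) (s : UnitAddCircle) (x : UnitAddTorus (Fin 3)),
          u j t (x + Pi.single (2 : Fin 3) s) = u j t x) →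
        (∃ E : ℝ, ∀ j, meanEnergy (u j) ≤ E) →
        Tendsto (fun j => longTimeAvgSup (fun t =>
          ∫ x, ‖Torus.planarProjE (u j t x) - W j t (Torus.planarProj x)‖ ^ 2)) atTop (𝓝 0) →
        Tendsto (fun j => meanDissipation (ν j) (u j)) atTop (𝓝 0) := by
  intro f hfinv hfs hfd hfz L W hWlip hWbd hWdiv ν u₀ u hν hν0 hLH huinv hE hcond
  obtain ⟨g, h, v₀, v, θ₀, θ, hgs, hgd, hgz, hhs, hhz, -, huv, hvLH, hθ₀, hθw, hEv, hEθ, hsplit⟩ :=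
    ReductionOffZero.stub_reductionOffZero f hfinv hfs hfd hfz ν u₀ u hν hLH huinv hE
  have hplanar : Tendsto (fun j => meanDissipation (ν j) (v j)) atTop (𝓝 0) :=
    PlanarNoAnomaly.stub_planarNoAnomaly g hgs hgd hgz ν v₀ v hν hν0 hvLH hEv
  -- the regular-condensation hypothesis read on the planar flow
  have hcond' : Tendsto (fun j => longTimeAvgSup (fun t => ∫ y, ‖v j t y - W j t y‖ ^ 2))
      atTop (𝓝 0) := by
    refine hcond.congr fun j => ?_
    unfold longTimeAvgSup
    refine limsup_congr ?_
    filter_upwards [eventually_gt_atTop (0 : ℝ)] with T hT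
    unfold timeMean
    congr 1
    refine intervalIntegral.integral_congr_ae (Eventually.of_forall fun t ht => ?_)
    rw [Set.uIoc_of_le hT.le] at ht
    rw [huv j t ht.1.ne']
    exact Condensate.integral_norm_sq_planarProjE_twoHalf_sub (θ j t)
      (((hvLH j) (t + 1) (by linarith [ht.1])).memLp t ⟨ht.1.le, by linarith⟩).1
      (lipschitzWith_slice (hWlip j) t).continuous
  have hscalar : Tendsto (fun j => longTimeAvgSup
      (fun t => ν j * (Torus.eScalarGradNormSq (θ j t)).toReal)) atTop (𝓝 0) :=
    scalarNoAnomaly_of_regularCondensate g h L W hgs hgz hhs hhz hWlip hWbd hWdiv ν v₀ v θ₀ θ hν hν0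
      hvLH hcond' hθ₀ hθw hEθ
  have hsum : Tendsto (fun j => meanDissipation (ν j) (v j) +
      longTimeAvgSup (fun t => ν j * (Torus.eScalarGradNormSq (θ j t)).toReal)) atTop (𝓝 0) := by
    simpa using hplanar.add hscalar
  exact squeeze_zero (fun j => meanDissipation_nonneg (hν j).le (u j)) hsplit hsum


/-- **Registered tools stub `stub_rcCertificate`** (the regular-condensate theorem, registered on
stmt-AnomalousDissipation-0211 with `ledger workitem stub-add`): the planar regular-condensate theorem and
the crux on regularly condensing `x₃`-invariant families. [folklore] -/
theorem stub_rcCertificate :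
    (∀ (g : UnitAddTorus (Fin 2) → EuclideanSpace ℝ (Fin 2)) (h : UnitAddTorus (Fin 2) → ℝ) (L : ℝ≥0)
      (W : ℕ → ℝ → UnitAddTorus (Fin 2) → EuclideanSpace ℝ (Fin 2)),
      Torus.IsSmooth g → Torus.HasZeroMean g → Torus.IsSmooth h → Torus.HasZeroMean h →
      (∀ j, LipschitzWith L (Function.uncurry (W j))) → (∀ j t x, ‖W j t x‖ ≤ L) →
      (∀ j t, Torus.IsWeaklyDivFree (W j t)) →
      ∀ (ν : ℕ → ℝ) (v₀ : ℕ → UnitAddTorus (Fin 2) → EuclideanSpace ℝ (Fin 2))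
        (v : ℕ → ℝ → UnitAddTorus (Fin 2) → EuclideanSpace ℝ (Fin 2))
        (θ₀ : ℕ → UnitAddTorus (Fin 2) → ℝ) (θ : ℕ → ℝ → UnitAddTorus (Fin 2) → ℝ),
        (∀ j, 0 < ν j) → Tendsto ν atTop (𝓝 0) →
        (∀ j, Torus.IsGlobalLerayHopf (ν j) (fun _ => g) (v₀ j) (v j)) →
        Tendsto (fun j => longTimeAvgSup (fun t => ∫ x, ‖v j t x - W j t x‖ ^ 2)) atTop (𝓝 0) →
        (∀ j, MemLp (θ₀ j) 2 volume) →
        (∀ j, Torus.IsWeakScalarTransportForced (ν j) (v j) (fun _ => h) (θ₀ j) (θ j)) →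
        (∃ E : ℝ, ∀ j, longTimeAvgSup (fun t => Torus.scalarL2Sq (θ j t)) ≤ E) →
        Tendsto (fun j => longTimeAvgSup (fun t => ν j * (Torus.eScalarGradNormSq (θ j t)).toReal))
          atTop (𝓝 0)) ∧
    (∀ f : UnitAddTorus (Fin 3) → EuclideanSpace ℝ (Fin 3),
      (∀ (s : UnitAddCircle) (x : UnitAddTorus (Fin 3)), f (x + Pi.single (2 : Fin 3) s) = f x) →
      Torus.IsSmooth f → Torus.IsDivFree f → Torus.HasZeroMean f →
      ∀ (L : ℝ≥0) (W : ℕ → ℝ → UnitAddTorus (Fin 2) → EuclideanSpace ℝ (Fin 2)),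
        (∀ j, LipschitzWith L (Function.uncurry (W j))) → (∀ j t x, ‖W j t x‖ ≤ L) →
        (∀ j t, Torus.IsWeaklyDivFree (W j t)) →
      ∀ (ν : ℕ → ℝ) (u₀ : ℕ → UnitAddTorus (Fin 3) → EuclideanSpace ℝ (Fin 3))
        (u : ℕ → ℝ → UnitAddTorus (Fin 3) → EuclideanSpace ℝ (Fin 3)),
        (∀ j, 0 < ν j) → Tendsto ν atTop (𝓝 0) →
        (∀ j, Torus.IsGlobalLerayHopf (ν j) (fun _ => f) (u₀ j) (u j)) →
        (∀ j (t : ℝ) (s : UnitAddCircle) (x : UnitAddTorus (Fin 3)),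
          u j t (x + Pi.single (2 : Fin 3) s) = u j t x) →
        (∃ E : ℝ, ∀ j, meanEnergy (u j) ≤ E) →
        Tendsto (fun j => longTimeAvgSup (fun t =>
          ∫ x, ‖Torus.planarProjE (u j t x) - W j t (Torus.planarProj x)‖ ^ 2)) atTop (𝓝 0) →
        Tendsto (fun j => meanDissipation (ν j) (u j)) atTop (𝓝 0)) :=
  ⟨scalarNoAnomaly_of_regularCondensate, twohalfdNeg_family_of_regularCondensate⟩

end Summit.AnomalousDissipation.AnomalousDissipation.Theorems.TwohalfdNeg.RegularCondensate
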